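import Literature.MathematicalPhysics.QuantumFieldTheory.Balaban1983to89.B11SectGSmoothCut

/-!
# `Balaban1983to89.B11SectGSmoothCutT` — the smooth-partition block norm with an ABSTRACT PAIR DIFFERENCE: the class of `B11SectGSmoothCut` whose Hölder
# part reads `w(x,x′)·|Δ_{x,x′} f|` for a given linear pair functional `Δ` (the flat `f x − f x′`, or print's TRANSPORTED `R(U(Γ_{x,x′}))f(x′) − f(x)`)
# obeying the cut-off product rule `|Δ(ζ_y f)| ≤ ζ_y(x′)·|Δ f| + |ζ_y x − ζ_y x′|·|f x|` — cutting cost `κ = 1 + Λ` whatever the transport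

T. Bałaban, *Propagators for lattice gauge theories in a background field*, Commun. Math. Phys. **99** (1985) 389–434
[`Balaban1985BackgroundPropagators`, "B9"]; [4] = T. Bałaban, *Propagators and renormalization transformations for lattice gauge
theories. II*, Commun. Math. Phys. **96** (1984) 223–250 [`Balaban1984PropagatorsII`]; [B11] = T. Bałaban, *The variational problem and
background fields in renormalization group method for lattice gauge theories*, Commun. Math. Phys. **102** (1985) 277–309 [`Balaban1985Variational`].

statement-level skeleton of published theorems with citation tags; proofs where landed; nothing here is a claim about the
Yang–Mills mass gap

THE PRINTED LOCI.  [B9] (3.40) p. 397: *"‖A‖_α = max sup |x − x′|^{−α}|R(U(Γ_{x,x′}))A_μ(x′) − A_μ(x)| … where Γ_{x,x′} is a shortest contour connecting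
points x and x′"* — the Hölder norms are built from TRANSPORTED differences; p. 398 L19: *"All these inequalities are invariant with respect to gauge
transformations of U"*; (3.43)–(3.45) p. 398: the entries are localised by *"ζ ∈ C₀^∞(Δ̃(y))"* with cost *"(‖ζ‖_α + |ζ|)"*; [4] (2.51)–(2.52) p. 232;
[B11] (189)–(190) p. 308.

WHY THIS FILE (cell `pub-ymgap`, node N06, seat dag-n06-l g21; the knit's WORD-TZ (dag-n06-d g13, INBOX l.40854): *«the bH13 ∕ bXH pin edition waits for
OPTION (2) = transported classes bHZᵀ(U)»*).  n06-w6's `B11SectGSmoothCut.BlockNorm.ofSmoothPartition` hard-codes the FLAT difference `f x − f x′` in its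
pair size; a flat Hölder class of coordinate functions is gauge-VARIANT, so every majorant into or out of it needs the small-gauge binder `hΘ`, which the
certificate (quantified over the gauge-invariant classes (3.35)–(3.36)) cannot feed.  THIS FILE abstracts the pair difference: a linear functional
`Δ x x′ : (X → ℝ) →ₗ[ℝ] ℝ` per pair, required only to satisfy the CUT-OFF PRODUCT RULE `|Δ x x′ (ζ_y·f)| ≤ ζ_y x′·|Δ x x′ f| + |ζ_y x − ζ_y x′|·|f x|`
(flat: `ζf(x) − ζf(x′) = (ζx − ζx′)f(x) + ζx′(f x − f x′)`; transported: `R(ζf)(x′) − ζf(x) = ζx′·(Rf(x′) − f x) + (ζx′ − ζx)·f x`, `ζ_y` constant on the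
colour fibre over a site — NO bound on `‖R(U)‖` enters, so the cutting cost is `1 + Λ` for EVERY configuration).  GENERIC KERNEL PIECE over any finite carrier:
* §1 ★ `Size.ofPairsT` — the pair size `⨆ [N y x ∧ P x x′]·w·|Δ x x′ f|` (a `B11SectGGlobal.Size`), `ofPairsT_term_le ∕ ofPairsT_sz_le ∕ ofPairsT_sz_mono_weight`;
* §2 ★★ `BlockNorm.ofSmoothPartitionT` — local size `W(y)·sup_{N y}|f| + (Size.ofPairsT …).sz y f`, cut `ζ_y·`, `IsLoc y f := f` vanishes off `N y`,
  `κ := 1 + Λ`; the seven laws PROVED under `Σ_y ζ_y = 1`, `0 ≤ ζ ≤ 1`, `supp ζ_y ⊂ N y`, the scale-covariant Lipschitz bound `w·|ζ_y x − ζ_y x′| ≤ Λ·W(y)`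
  (base `x ∈ N y`, partner `P x x′`) and the product rule `hΔ`;
* §3 `ofSmoothPartitionT_loc ∕ _cut_apply ∕ _isLoc_iff ∕ _κ`, ★ `hasMaj_into_ofSmoothPartitionT` (pointwise + pairwise OUTPUT bounds ⇒ majorant into the class
  — print's (3.43)∕(3.45) output shape), `hasMaj_from_ofSmoothPartitionT_iff` (the input shape of (3.44)∕(3.45));
* §4 `flatDif` and `ofPairsT_flatDif` (the flat functional gives back n06-w6's pair size, value by value).
HONEST SCOPE.  Generic finite-dimensional bookkeeping; nothing of [B9]∕[4]∕[B11] asserted; no pin, no schema; COUNT-NEUTRAL; N06 NOT discharged; nothing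
continuum, nothing about the mass gap.  Cell `pub-ymgap` (HUMAN RULING D-0062), Track A node N06 [B9], seat `pub-ymgap-dag-n06-l` (g21), 2026-08-28.
-/

noncomputable section

namespace Literature.MathematicalPhysics.QuantumFieldTheory.Balaban1983to89.B11SectGSmoothCutT

open Finset B6RandomWalk
open B11SectG (BlockNorm HasMaj)
open B11SectGGlobal (Size HasMajG)
open B11SectGGlobalSizes
open B11SectGSmoothCut (mulCut mulCut_apply)

variable {g : B6.Geometry} {X : Type} [Fintype X]

/-! ## §1 The pair size of an abstract pair functional -/

/-- ★ **THE PAIR SIZE OF A LINEAR PAIR FUNCTIONAL** `Δ`: `sz y f := ⨆_{(x,x′)} [N y x ∧ P x x′]·w(x,x′)·|Δ x x′ f|` — for the transported functional this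
is the local reading of print's gauge-invariant Hölder part `‖·‖_α` (3.40). [cite: Balaban1985BackgroundPropagators, (3.40) p.397; Balaban1984PropagatorsII, (2.137) p.247] -/
def Size.ofPairsT (g : B6.Geometry) (mem : X → g.Site → Prop) [∀ x y, Decidable (mem x y)] (P : X → X → Prop) [DecidableRel P] (w : X → X → ℝ)
    (hw : ∀ z z', 0 ≤ w z z') (Δ : X → X → (X → ℝ) →ₗ[ℝ] ℝ) : Size g (X → ℝ) where
  sz y f := ⨆ p : X × X, if mem p.1 y ∧ P p.1 p.2 then w p.1 p.2 * |Δ p.1 p.2 f| else 0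
  nonneg y f := Real.iSup_nonneg fun p => by
    split_ifs
    · exact mul_nonneg (hw _ _) (abs_nonneg _)
    · exact le_rfl
  zero y := by simp only [map_zero, abs_zero, mul_zero, ite_self, Real.iSup_const_zero]
  add_le y f f' := by
    have h0 : 0 ≤ (⨆ p : X × X, if mem p.1 y ∧ P p.1 p.2 then w p.1 p.2 * |Δ p.1 p.2 f| else 0) :=
      Real.iSup_nonneg fun p => by split_ifs; exacts [mul_nonneg (hw _ _) (abs_nonneg _), le_rfl]
    have h0' : 0 ≤ (⨆ p : X × X, if mem p.1 y ∧ P p.1 p.2 then w p.1 p.2 * |Δ p.1 p.2 f'| else 0) :=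
      Real.iSup_nonneg fun p => by split_ifs; exacts [mul_nonneg (hw _ _) (abs_nonneg _), le_rfl]
    refine Real.iSup_le (fun p => ?_) (add_nonneg h0 h0')
    have hF := le_ciSup (f := fun p : X × X => if mem p.1 y ∧ P p.1 p.2 then w p.1 p.2 * |Δ p.1 p.2 f| else 0) (Finite.bddAbove_range _) p
    have hF' := le_ciSup (f := fun p : X × X => if mem p.1 y ∧ P p.1 p.2 then w p.1 p.2 * |Δ p.1 p.2 f'| else 0) (Finite.bddAbove_range _) p
    split_ifs with h
    · rw [if_pos h] at hF hF'
      rw [map_add]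
      calc w p.1 p.2 * |Δ p.1 p.2 f + Δ p.1 p.2 f'| ≤ w p.1 p.2 * (|Δ p.1 p.2 f| + |Δ p.1 p.2 f'|) :=
            mul_le_mul_of_nonneg_left (abs_add_le _ _) (hw _ _)
        _ ≤ _ := by rw [mul_add]; exact add_le_add hF hF'
    · exact add_nonneg h0 h0'
  neg y f := by simp only [map_neg, abs_neg]

section Terms

variable (mem : X → g.Site → Prop) [∀ x y, Decidable (mem x y)] (P : X → X → Prop) [DecidableRel P] (w : X → X → ℝ) (hw : ∀ z z', 0 ≤ w z z')
  (Δ : X → X → (X → ℝ) →ₗ[ℝ] ℝ)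

/-- every weighted pair term of the domain is below the pair size. [cite: Balaban1985BackgroundPropagators, (3.40) p.397, bookkeeping] -/
theorem ofPairsT_term_le {y : g.Site} {z z' : X} (hz : mem z y) (hP : P z z') (f : X → ℝ) :
    w z z' * |Δ z z' f| ≤ (Size.ofPairsT g mem P w hw Δ).sz y f := by
  have h := le_ciSup (f := fun p : X × X => if mem p.1 y ∧ P p.1 p.2 then w p.1 p.2 * |Δ p.1 p.2 f| else 0) (Finite.bddAbove_range _) (z, z')
  simp only [if_pos (And.intro hz hP)] at h
  exact h

/-- the pair size is below any common bound `M ≥ 0` of the weighted pair terms. [cite: Balaban1985BackgroundPropagators, (3.40) p.397, bookkeeping] -/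
theorem ofPairsT_sz_le {y : g.Site} {f : X → ℝ} {M : ℝ} (hM : 0 ≤ M) (h : ∀ z z', mem z y → P z z' → w z z' * |Δ z z' f| ≤ M) :
    (Size.ofPairsT g mem P w hw Δ).sz y f ≤ M := by
  refine Real.iSup_le (fun p => ?_) hM
  split_ifs with hp
  · exact h p.1 p.2 hp.1 hp.2
  · exact hM

/-- the pair size is MONOTONE IN THE WEIGHT on its domain: `w ≤ w′` on the pairs based in the block ⇒ `sz_w ≤ sz_{w′}` (for Hölder weights `t^{−s}`,
`t ≤ 1`: monotone in the exponent — the domination behind the graded class). [cite: Balaban1985BackgroundPropagators, (3.40) p.397, bookkeeping] -/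
theorem ofPairsT_sz_mono_weight {w' : X → X → ℝ} (hw' : ∀ z z', 0 ≤ w' z z') {y : g.Site}
    (h : ∀ z z', mem z y → P z z' → w z z' ≤ w' z z') (f : X → ℝ) :
    (Size.ofPairsT g mem P w hw Δ).sz y f ≤ (Size.ofPairsT g mem P w' hw' Δ).sz y f :=
  ofPairsT_sz_le mem P w hw Δ (Size.nonneg _ _ _) fun z z' hz hP =>
    (mul_le_mul_of_nonneg_right (h z z' hz hP) (abs_nonneg _)).trans (ofPairsT_term_le mem P w' hw' Δ hz hP f)

end Terms

/-! ## §2 The smooth-partition block norm with an abstract pair difference -/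

section Construction

variable (N : g.Site → X → Prop) [∀ y x, Decidable (N y x)] (P : X → X → Prop) [DecidableRel P] (w : X → X → ℝ) (hw : ∀ z z', 0 ≤ w z z')
  (W : g.Site → ℝ) (hW : ∀ y, 0 ≤ W y) (ζ : g.Site → X → ℝ) (Λ : ℝ) (Δ : X → X → (X → ℝ) →ₗ[ℝ] ℝ)

/-- ★★ **THE SMOOTH-PARTITION BLOCK NORM WITH AN ABSTRACT PAIR DIFFERENCE**: local size `W(y)·sup_{N y}|f| + ⨆ {w x x′·|Δ x x′ f| : x ∈ N y, P x x′}`,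
cut-offs `ζ_y·` from a partition of unity subordinate to the neighbourhoods, localisation `supp f ⊂ N y`, cutting cost `κ = 1 + Λ` — under the scale-covariant
Lipschitz bound `w·|ζ_y x − ζ_y x′| ≤ Λ·W(y)` and the PRODUCT RULE `|Δ x x′ (ζ_y·f)| ≤ ζ_y x′·|Δ x x′ f| + |ζ_y x − ζ_y x′|·|f x|` (flat and transported
differences alike). [cite: Balaban1985BackgroundPropagators, (3.40) p.397 + (3.43)–(3.45) p.398; Balaban1984PropagatorsII, (2.51)–(2.52) p.232; Balaban1985Variational, (189)–(190) p.308] -/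
def _root_.Literature.MathematicalPhysics.QuantumFieldTheory.Balaban1983to89.B11SectG.BlockNorm.ofSmoothPartitionT (hΛ : 0 ≤ Λ)
    (hsum : ∀ x, ∑ y : g.Site, ζ y x = 1) (h0 : ∀ y x, 0 ≤ ζ y x) (h1 : ∀ y x, ζ y x ≤ 1) (hsupp : ∀ y x, ¬ N y x → ζ y x = 0)
    (hLip : ∀ y x x', N y x → P x x' → w x x' * |ζ y x - ζ y x'| ≤ Λ * W y)
    (hΔ : ∀ (y : g.Site) (x x' : X) (f : X → ℝ), |Δ x x' (mulCut ζ y f)| ≤ ζ y x' * |Δ x x' f| + |ζ y x - ζ y x'| * |f x|) :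
    BlockNorm g (X → ℝ) where
  loc y f := W y * (Size.ofSup g (fun x y => N y x)).sz y f + (Size.ofPairsT g (fun x y => N y x) P w hw Δ).sz y f
  cut y := mulCut ζ y
  IsLoc y f := ∀ x, ¬ N y x → f x = 0
  κ := 1 + Λ
  κ_nonneg := add_nonneg zero_le_one hΛ
  loc_nonneg y f := add_nonneg (mul_nonneg (hW y) (Size.nonneg _ _ _)) (Size.nonneg _ _ _)
  loc_zero y := by rw [Size.zero, Size.zero, mul_zero, add_zero]
  loc_add_le y f f' := by
    have h₁ := (Size.ofSup g (fun x y => N y x)).add_le y f f'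
    have h₂ := (Size.ofPairsT g (fun x y => N y x) P w hw Δ).add_le y f f'
    have hW0 := hW y
    nlinarith [mul_le_mul_of_nonneg_left h₁ hW0]
  loc_neg y f := by rw [Size.neg, Size.neg]
  sum_cut f := by
    funext x
    rw [Finset.sum_apply]
    simp only [mulCut_apply]
    rw [← Finset.sum_mul, hsum x, one_mul]
  isLoc_cut y f x hx := by rw [mulCut_apply, hsupp y x hx, zero_mul]
  loc_cut_le y f := by
    have hS0 : 0 ≤ (Size.ofSup g (fun x y => N y x)).sz y f := Size.nonneg _ _ _
    have hH0 : 0 ≤ (Size.ofPairsT g (fun x y => N y x) P w hw Δ).sz y f := Size.nonneg _ _ _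
    have hSζ : (Size.ofSup g (fun x y => N y x)).sz y (mulCut ζ y f) ≤ (Size.ofSup g (fun x y => N y x)).sz y f := by
      refine ofSup_sz_le _ hS0 fun x hx => ?_
      rw [mulCut_apply, abs_mul, abs_of_nonneg (h0 y x)]
      exact (mul_le_of_le_one_left (abs_nonneg _) (h1 y x)).trans (ofSup_abs_le _ hx f)
    have hW0 : 0 ≤ W y := hW y
    have hHζ : (Size.ofPairsT g (fun x y => N y x) P w hw Δ).sz y (mulCut ζ y f) ≤
        Λ * W y * (Size.ofSup g (fun x y => N y x)).sz y f + (Size.ofPairsT g (fun x y => N y x) P w hw Δ).sz y f := by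
      refine ofPairsT_sz_le _ _ _ _ _ (add_nonneg (mul_nonneg (mul_nonneg hΛ hW0) hS0) hH0) fun z z' hz hP => ?_
      calc w z z' * |Δ z z' (mulCut ζ y f)|
          ≤ w z z' * (ζ y z' * |Δ z z' f| + |ζ y z - ζ y z'| * |f z|) := mul_le_mul_of_nonneg_left (hΔ y z z' f) (hw z z')
        _ = ζ y z' * (w z z' * |Δ z z' f|) + (w z z' * |ζ y z - ζ y z'|) * |f z| := by ring
        _ ≤ 1 * (Size.ofPairsT g (fun x y => N y x) P w hw Δ).sz y f + Λ * W y * (Size.ofSup g (fun x y => N y x)).sz y f :=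
            add_le_add (mul_le_mul (h1 y z') (ofPairsT_term_le _ _ _ _ _ hz hP f) (mul_nonneg (hw _ _) (abs_nonneg _)) zero_le_one)
              (mul_le_mul (hLip y z z' hz hP) (ofSup_abs_le _ hz f) (abs_nonneg _) (mul_nonneg hΛ hW0))
        _ = _ := by rw [one_mul, add_comm]
    show W y * (Size.ofSup g (fun x y => N y x)).sz y (mulCut ζ y f) + (Size.ofPairsT g (fun x y => N y x) P w hw Δ).sz y (mulCut ζ y f) ≤
        (1 + Λ) * (W y * (Size.ofSup g (fun x y => N y x)).sz y f + (Size.ofPairsT g (fun x y => N y x) P w hw Δ).sz y f)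
    have hΛH : 0 ≤ Λ * (Size.ofPairsT g (fun x y => N y x) P w hw Δ).sz y f := mul_nonneg hΛ hH0
    calc W y * (Size.ofSup g (fun x y => N y x)).sz y (mulCut ζ y f) + (Size.ofPairsT g (fun x y => N y x) P w hw Δ).sz y (mulCut ζ y f)
        ≤ W y * (Size.ofSup g (fun x y => N y x)).sz y f +
            (Λ * W y * (Size.ofSup g (fun x y => N y x)).sz y f + (Size.ofPairsT g (fun x y => N y x) P w hw Δ).sz y f) :=
          add_le_add (mul_le_mul_of_nonneg_left hSζ hW0) hHζ
      _ ≤ _ := by nlinarith [hΛH]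

end Construction

/-! ## §3 Reading the construction -/

variable {N : g.Site → X → Prop} [∀ y x, Decidable (N y x)] {P : X → X → Prop} [DecidableRel P] {w : X → X → ℝ} {hw : ∀ z z', 0 ≤ w z z'}
  {W : g.Site → ℝ} {hW : ∀ y, 0 ≤ W y} {ζ : g.Site → X → ℝ} {Λ : ℝ} {Δ : X → X → (X → ℝ) →ₗ[ℝ] ℝ}
variable {hΛ : 0 ≤ Λ} {hsum : ∀ x, ∑ y : g.Site, ζ y x = 1} {h0 : ∀ y x, 0 ≤ ζ y x} {h1 : ∀ y x, ζ y x ≤ 1}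
  {hsupp : ∀ y x, ¬ N y x → ζ y x = 0} {hLip : ∀ y x x', N y x → P x x' → w x x' * |ζ y x - ζ y x'| ≤ Λ * W y}
  {hΔ : ∀ (y : g.Site) (x x' : X) (f : X → ℝ), |Δ x x' (mulCut ζ y f)| ≤ ζ y x' * |Δ x x' f| + |ζ y x - ζ y x'| * |f x|}

/-- the local size is `W(y)·(sup over N y) + (pair size of Δ)`, read on the unrestricted vector. [cite: Balaban1985BackgroundPropagators, (3.39)–(3.40) p.397, bookkeeping] -/
theorem ofSmoothPartitionT_loc (y : g.Site) (f : X → ℝ) :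
    (BlockNorm.ofSmoothPartitionT N P w hw W hW ζ Λ Δ hΛ hsum h0 h1 hsupp hLip hΔ).loc y f =
      W y * (Size.ofSup g (fun x y => N y x)).sz y f + (Size.ofPairsT g (fun x y => N y x) P w hw Δ).sz y f := rfl

/-- the cut-off is the multiplication by `ζ_y`. [cite: Balaban1985BackgroundPropagators, (3.43) p.398, bookkeeping] -/
theorem ofSmoothPartitionT_cut_apply (y : g.Site) (f : X → ℝ) (x : X) :
    (BlockNorm.ofSmoothPartitionT N P w hw W hW ζ Λ Δ hΛ hsum h0 h1 hsupp hLip hΔ).cut y f x = ζ y x * f x := rfl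

/-- localisation = support in the neighbourhood `N y`. [cite: Balaban1985BackgroundPropagators, (3.44) p.398, bookkeeping] -/
theorem ofSmoothPartitionT_isLoc_iff (y : g.Site) (f : X → ℝ) :
    (BlockNorm.ofSmoothPartitionT N P w hw W hW ζ Λ Δ hΛ hsum h0 h1 hsupp hLip hΔ).IsLoc y f ↔ ∀ x, ¬ N y x → f x = 0 := Iff.rfl

/-- the cutting cost is `1 + Λ`, whatever the pair functional (no transporter norm enters). [cite: Balaban1984PropagatorsII, (2.52) p.232, bookkeeping] -/
theorem ofSmoothPartitionT_κ : (BlockNorm.ofSmoothPartitionT N P w hw W hW ζ Λ Δ hΛ hsum h0 h1 hsupp hLip hΔ).κ = 1 + Λ := rfl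

variable {F₁ F₂ : Type} [AddCommGroup F₁] [Module ℝ F₁] [AddCommGroup F₂] [Module ℝ F₂]

/-- ★ **A LOCALIZED MAJORANT INTO THE CLASS FROM POINTWISE + PAIRWISE OUTPUT BOUNDS** (print's (3.43)∕(3.45) output side, transported differences): if for
every input `μ` localized at `y′` in `b₁` the output obeys `|(T μ)(x)| ≤ K₀(y,y′)·loc_{y′} μ` on `N y` and `w(x,x′)·|Δ x x′ (T μ)| ≤ K₁(y,y′)·loc_{y′} μ` on the
pairs based in `N y` (`K₀, K₁ ≥ 0`), then `T` has the majorant `W(y)·K₀ + K₁` into the class. [cite: Balaban1985BackgroundPropagators, (3.43)–(3.45) p.398; Balaban1984PropagatorsII, (2.51) p.232] -/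
theorem hasMaj_into_ofSmoothPartitionT {b₁ : BlockNorm g F₁} {T : F₁ →ₗ[ℝ] (X → ℝ)} {K₀ K₁ : g.Site → g.Site → ℝ}
    (hK₀ : ∀ a b, 0 ≤ K₀ a b) (hK₁ : ∀ a b, 0 ≤ K₁ a b)
    (hpt : ∀ (y' : g.Site) (μ : F₁), b₁.IsLoc y' μ → ∀ (y : g.Site) (x : X), N y x → |T μ x| ≤ K₀ y y' * b₁.loc y' μ)
    (hpr : ∀ (y' : g.Site) (μ : F₁), b₁.IsLoc y' μ → ∀ (y : g.Site) (x x' : X), N y x → P x x' → w x x' * |Δ x x' (T μ)| ≤ K₁ y y' * b₁.loc y' μ) :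
    HasMaj b₁ (BlockNorm.ofSmoothPartitionT N P w hw W hW ζ Λ Δ hΛ hsum h0 h1 hsupp hLip hΔ) T (fun y y' => W y * K₀ y y' + K₁ y y') := by
  intro y' μ hμ y
  rw [ofSmoothPartitionT_loc, add_mul]
  have hl0 : 0 ≤ b₁.loc y' μ := b₁.loc_nonneg _ _
  refine add_le_add ?_ ?_
  · rw [mul_assoc]
    exact mul_le_mul_of_nonneg_left (ofSup_sz_le _ (mul_nonneg (hK₀ _ _) hl0) fun x hx => hpt y' μ hμ y x hx) (hW y)
  · exact ofPairsT_sz_le _ _ _ _ _ (mul_nonneg (hK₁ _ _) hl0) fun x x' hx hP => hpr y' μ hμ y x x' hx hP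

/-- **A MAJORANT OUT OF THE CLASS** reads print's input side: inputs vanishing off `N y′`, sized by `W(y′)·sup_{N y′}|λ| + (pair size of Δ)` — the definition
unfolded. [cite: Balaban1985BackgroundPropagators, (3.44)–(3.45) p.398; Balaban1984PropagatorsII, (2.51) p.232] -/
theorem hasMaj_from_ofSmoothPartitionT_iff {b₂ : BlockNorm g F₂} {T : (X → ℝ) →ₗ[ℝ] F₂} {K : g.Site → g.Site → ℝ} :
    HasMaj (BlockNorm.ofSmoothPartitionT N P w hw W hW ζ Λ Δ hΛ hsum h0 h1 hsupp hLip hΔ) b₂ T K ↔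
      ∀ (y' : g.Site) (lam : X → ℝ), (∀ x, ¬ N y' x → lam x = 0) → ∀ y : g.Site,
        b₂.loc y (T lam) ≤ K y y' * (W y' * (Size.ofSup g (fun x y => N y x)).sz y' lam + (Size.ofPairsT g (fun x y => N y x) P w hw Δ).sz y' lam) :=
  Iff.rfl

/-! ## §4 The flat pair functional -/

/-- the FLAT pair difference `f x − f x′` as a linear pair functional. [cite: Balaban1985BackgroundPropagators, (3.40) p.397 (the case U = 1), dictionary] -/
def flatDif (x x' : X) : (X → ℝ) →ₗ[ℝ] ℝ where
  toFun f := f x - f x'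
  map_add' f f' := by simp only [Pi.add_apply]; ring
  map_smul' r f := by simp only [Pi.smul_apply, smul_eq_mul, RingHom.id_apply]; ring

omit [Fintype X] in
/-- `flatDif x x′ f = f x − f x′`. [cite: Balaban1985BackgroundPropagators, (3.40) p.397, dictionary] -/
@[simp] theorem flatDif_apply (x x' : X) (f : X → ℝ) : flatDif x x' f = f x - f x' := rfl

omit [Fintype X] in
/-- the flat functional obeys the cut-off product rule (with EQUALITY in the form `(ζx − ζx′)·f x + ζx′·(f x − f x′)`).
[cite: Balaban1985BackgroundPropagators, (3.43) p.398, bookkeeping] -/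
theorem flatDif_mulCut_le (ζ : g.Site → X → ℝ) (h0 : ∀ y x, 0 ≤ ζ y x) (y : g.Site) (x x' : X) (f : X → ℝ) :
    |flatDif x x' (mulCut ζ y f)| ≤ ζ y x' * |flatDif x x' f| + |ζ y x - ζ y x'| * |f x| := by
  rw [flatDif_apply, flatDif_apply, mulCut_apply, mulCut_apply]
  have hsplit : ζ y x * f x - ζ y x' * f x' = ζ y x' * (f x - f x') + (ζ y x - ζ y x') * f x := by ring
  rw [hsplit]
  calc _ ≤ |ζ y x' * (f x - f x')| + |(ζ y x - ζ y x') * f x| := abs_add_le _ _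
    _ = _ := by rw [abs_mul, abs_mul, abs_of_nonneg (h0 y x')]

/-- with the flat functional the pair size IS n06-w6's `Size.ofPairs`, value by value. [cite: Balaban1985BackgroundPropagators, (3.40) p.397, bookkeeping] -/
theorem ofPairsT_flatDif_sz (mem : X → g.Site → Prop) [∀ x y, Decidable (mem x y)] (P : X → X → Prop) [DecidableRel P] (w : X → X → ℝ)
    (hw : ∀ z z', 0 ≤ w z z') (y : g.Site) (f : X → ℝ) :
    (Size.ofPairsT g mem P w hw flatDif).sz y f = (Size.ofPairs g mem P w hw).sz y f := rfl

end Literature.MathematicalPhysics.QuantumFieldTheory.Balaban1983to89.B11SectGSmoothCutT
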